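import Summits.BirchSwinnertonDyer.Rank1Residual.X11b.CongruentSelmerTransferBounds
import Summits.BirchSwinnertonDyer.Rank1Residual.X11b.BDPRouteSelmerCountLemmas
import HarnessLib

/-!
# Route `GenusKolyvaginAtTwo`, crux #2 `GenusPrimitiveSupplyAtTwo` (stmt-BirchSwinnertonDyer-22136):
# Mazur–Rubin Cor. 3.4 (i), NON-STRICT case, for a congruent pair — `#Sel(Y) · p = #Sel(E)` — from X11b's
# sandwich, the one-place Poitou–Tate count and transversality (the DOWN direction the SUPPLY uses)

Width seat `bsd-line-gk2-p5` g8 (cell `bsd-f1-sign2`, SUPPLY lineage), fourth file of the series (crux workfile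
`Lines/genus-supply-mr-instantiation.md`). THEOREMS ONLY (no definition, no named fact, no `sorry`); helper
`--supports stmt-BirchSwinnertonDyer-22136`; no item is closed; BSD is not proved by any of this.

WHY. Every SUPPLY consumer of the line (gk2-p4 g7 `exists_kolyvaginPrime_genusPair_selmer_of_cor34i`, gk2-p5 g6/g7
`supply_DEF1_*`) uses the named fact `MazurRubin2010.cor34i_singleton_rat` ONLY in the direction «`Sel₂(E)` NOT strict at
the twisting prime `ℓ` ⟹ `#Sel₂(E^{(ℓ*)}) = #Sel₂(E)/2`». In the Selmer-structure currency of cell `b2b-bsdres` (X11b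
`CongruentTransfer`: transport `𝓐 = φ_*𝓚_Y`, sandwich `H¹_{𝓚_S} ≤ H¹_𝓐 ≤ H¹_{𝓚^S}`, the one-place Poitou–Tate count
`[H¹_{𝓚^{v₀}} : H¹_{𝓚_{v₀}}] = #E(K_{v₀})[p]·#(𝓞/p)`, the transversality exclusion) that direction is a GENERIC theorem about
a congruent pair `Y[p] ≅ E[p]` — this file proves it, for every number field `K` and prime `p`:

* `natCard_selmerGroup_mul_eq_of_transverse_of_localization_ne_zero` — given the two standard print facts
  `poitouTate_selmerStructure_duality_real K` (Milne ADT I.4.10 + real places) and `localEulerPoincareCharacteristic K_v` (Tate)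
  as HYPOTHESES (exactly as X11b does), inverse intertwining maps `φ : Y[p] ⇄ E[p] : ψ`, the transported structure `𝓐`
  (`h𝓐`), ONE finite place `v₀` with: agreement `𝓐 v = 𝓚_E v` at every `v ≠ v₀`, transversality `𝓐 v₀ ⊓ 𝓚_E v₀ = ⊥`,
  `t_{v₀} = #E(K_{v₀})[p]·#(𝓞_{v₀}/p) = p`, and a Selmer class of `E` with non-zero localisation at `v₀` (NOT strict):
  **`#Sel^{(p)}(Y/K) · p = #Sel^{(p)}(E/K)`**. Proof: `Sel(E) ≠ H¹_{𝓚_{v₀}}` (the class), so by the index-`p` sandwich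
  `Sel(E) = H¹_{𝓚^{v₀}}`; if `H¹_𝓐` were the relaxed group it would contain that class, whose localisation would lie in
  `𝓐_{v₀} ⊓ 𝓚_{E,v₀} = ⊥` — so `H¹_𝓐 = H¹_{𝓚_{v₀}}`, of index `p` in `Sel(E)`, and `#H¹_𝓐 = #Sel(Y)` by transport.

For the twist `Y = E^{(d)}` at `p = 2` the agreement hypothesis is supplied place by place by this series (split places:
p619414; real place on `Δ < 0` and silent finite places: p619918; good unramified places: X11b `transport_kummer_inr_eq_of_good`);
the transversality at the ramified prime is Mazur–Rubin's Lemma 2.11 (NOT in the tree); `t_ℓ = 2` at a Kolyvagin prime on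
`Δ < 0` is `#E(ℚ_ℓ)[2] = 2` (gk2-p5 g6 `GenusKolyTwin.natCard_twoTorsion_padic_eq_two_of_existsUnique`, ℚ_ℓ-currency).

References: [MazurRubin2010] Def. 3.1, Lemma 3.2, Prop. 3.3, Cor. 3.4 (i); [MilneADT2006] I Thm. 2.8, Lemma 3.3, Thm. 4.10;
[Zhang2014] Lemma 5.3, Prop. 5.4; [Howard2004HeegnerKolyvagin] Thm. 2.1.11.
-/

set_option linter.dupNamespace false -- tree convention: `Summit.BirchSwinnertonDyer.BirchSwinnertonDyer.Theorems` (summit = sub-problem)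
set_option autoImplicit false

noncomputable section

open scoped Classical ContRepresentation

namespace Summit.BirchSwinnertonDyer.BirchSwinnertonDyer.Theorems.GenusKolyTwistLocal

open WeierstrassCurve Field NumberField IsDedekindDomain Function
open Literature.NumberTheory.EllipticCurves Literature.NumberTheory.GaloisRepresentations
open Literature.NumberTheory.GaloisRepresentations.DiscreteGaloisModule (SelmerStructure)
open Literature.NumberTheory.GaloisCohomology
open Summit.BirchSwinnertonDyer.Rank1Residual.X11b.CongruentTransfer
open Summit.BirchSwinnertonDyer.Rank1Residual.X11b.SelmerCount (card_mul_relIndex_of_le)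
open Summit.BirchSwinnertonDyer.Rank1Residual.X11b.KummerPT (kummerStrict kummerRelaxed)

/-! ## §11 Index-`p` sandwiches -/

section Sandwich

variable {G : Type*} [AddCommGroup G]

/-- In a sandwich `H₁ ≤ A ≤ H₂` of index `[H₂ : H₁] = p` prime, `A` is one of the two ends:
`H₁.relIndex A = 1` (i.e. `A ≤ H₁`, so `A = H₁`) or `A.relIndex H₂ = 1` (i.e. `H₂ ≤ A`, so `A = H₂`). [folklore] -/
theorem eq_or_eq_of_le_of_le_of_relIndex_prime {p : ℕ} (hp : p.Prime) {H₁ A H₂ : AddSubgroup G}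
    (h₁ : H₁ ≤ A) (h₂ : A ≤ H₂) (hidx : H₁.relIndex H₂ = p) : A = H₁ ∨ A = H₂ := by
  have hmul := AddSubgroup.relIndex_mul_relIndex H₁ A H₂ h₁ h₂
  rw [hidx] at hmul
  have hdvd : A.relIndex H₂ ∣ p := ⟨H₁.relIndex A, by rw [mul_comm]; exact hmul.symm⟩
  rcases hp.eq_one_or_self_of_dvd _ hdvd with h | h
  · exact Or.inr (le_antisymm h₂ (AddSubgroup.relIndex_eq_one.mp h))
  · rw [h] at hmul
    have h1 : H₁.relIndex A = 1 := Nat.eq_of_mul_eq_mul_right hp.pos (by rw [one_mul]; exact hmul)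
    exact Or.inl (le_antisymm (AddSubgroup.relIndex_eq_one.mp h1) h₁)

end Sandwich

/-! ## §12 The DOWN transfer for a congruent pair with one transverse, non-strict place -/

section Down

variable {K : Type} [Field K] [NumberField K] (W Y : WeierstrassCurve K) [W.IsElliptic] (p : ℕ) [hp : Fact p.Prime]

/-- **Mazur–Rubin Cor. 3.4 (i), non-strict case, for a congruent pair `Y[p] ≅ E[p]` over a number field `K`
(`#Sel^{(p)}(Y) · p = #Sel^{(p)}(E)`).** HYPOTHESES: the print facts `poitouTate_selmerStructure_duality_real K` (Milne ADT
I.4.10 with real places) and `localEulerPoincareCharacteristic K_v` (Tate, Milne I.2.8) — exactly as in X11b's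
`relIndex_kummerStrict_kummerRelaxed_singleton_eq_of_facts`; inverse `Γ_K`-intertwining maps `φ : Y[p] → E[p]`, `ψ`;
the transported Kummer structure `𝓐 = φ_*𝓚_Y` (`h𝓐`); one finite place `v₀` such that `𝓐` AGREES with `𝓚_E` at every
other place, is TRANSVERSE to it at `v₀` (`𝓐_{v₀} ⊓ 𝓚_{E,v₀} = ⊥`, Mazur–Rubin Lemma 2.11 for twists), `t_{v₀}(E,p) =
#E(K_{v₀})[p]·#(𝓞_{v₀}/p) = p`, and `Sel^{(p)}(E)` has a class with non-zero localisation at `v₀` (NOT strict). CONCLUSION: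
`#Sel^{(p)}(Y/K) · p = #Sel^{(p)}(E/K)`. Proof: sandwiches of index `p` (`selmerGroup_sandwich_kummer`,
`selmerGroup_sandwich_of_agree`, the Poitou–Tate count); the non-strict class forces `Sel(E) = H¹_{𝓚^{v₀}}` and — by
transversality — `H¹_𝓐 ≠ H¹_{𝓚^{v₀}}`, hence `H¹_𝓐 = H¹_{𝓚_{v₀}}`; transport `#H¹_𝓐 = #Sel(Y)`.
[cite: MazurRubin2010, Prop. 3.3 and Cor. 3.4 (i) (arXiv:0904.3709 p. 10)] [cite: MilneADT2006, Ch. I, Thm. 4.10]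
[cite: Zhang2014, Lemma 5.3 (p. 225)] -/
theorem natCard_selmerGroup_mul_eq_of_transverse_of_localization_ne_zero
    (hPT : poitouTate_selmerStructure_duality_real K)
    (hEP : ∀ v : HeightOneSpectrum (𝓞 K), localEulerPoincareCharacteristic (v.adicCompletion K))
    (φ : (Y.torsionGaloisModule (p : ℤ)).toContRepresentation →ⁱL
      (W.torsionGaloisModule (p : ℤ)).toContRepresentation)
    (ψ : (W.torsionGaloisModule (p : ℤ)).toContRepresentation →ⁱL
      (Y.torsionGaloisModule (p : ℤ)).toContRepresentation)
    (hψφ : ∀ a, ψ (φ a) = a) (hφψ : ∀ b, φ (ψ b) = b)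
    (𝓐 : SelmerStructure (W.torsionGaloisModule (p : ℤ)))
    (h𝓐 : ∀ v, 𝓐 v = (Y.kummerSelmerStructure (p : ℤ) v).map
      (galoisCohomology.map (φ.restrictField (Place.Completion v)) 1))
    (v₀ : HeightOneSpectrum (𝓞 K))
    (hagree : ∀ v : Place K, v ≠ Sum.inr v₀ → 𝓐 v = W.kummerSelmerStructure (p : ℤ) v)
    (htr : 𝓐 (Sum.inr v₀) ⊓ W.kummerSelmerStructure (p : ℤ) (Sum.inr v₀) = ⊥)
    (ht : Nat.card (nsmulAddMonoidHom p : (W.baseChange (v₀.adicCompletion K)).toAffine.Point →+ _).ker *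
        Nat.card (v₀.adicCompletionIntegers K ⧸ Ideal.span {(p : v₀.adicCompletionIntegers K)}) = p)
    (hns : ∃ c ∈ (W.kummerSelmerStructure (p : ℤ)).selmerGroup,
      galoisCohomology.localization (W.torsionGaloisModule (p : ℤ)) (Sum.inr v₀) 1 c ≠ 0) :
    Nat.card (Y.selmerGroup (p : ℤ)) * p = Nat.card (W.selmerGroup (p : ℤ)) := by
  set S : Finset (Place K) := {(Sum.inr v₀ : Place K)} with hS
  have hv₀S : (Sum.inr v₀ : Place K) ∈ S := by simp [hS]
  have hagreeS : ∀ v ∉ S, 𝓐 v = W.kummerSelmerStructure (p : ℤ) v := fun v hv ↦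
    hagree v (by simpa [hS] using hv)
  -- the two sandwiches of index `p`
  obtain ⟨hAlo, hAhi⟩ := selmerGroup_sandwich_of_agree W p S hagreeS
  obtain ⟨hKlo, hKhi⟩ := selmerGroup_sandwich_kummer W p S
  have hidx : (kummerStrict W p S).selmerGroup.relIndex
      (kummerRelaxed W p S).selmerGroup = p := by
    rw [hS, relIndex_kummerStrict_kummerRelaxed_singleton_eq_of_facts W p hPT hEP v₀, ht]
  obtain ⟨c, hcK, hc⟩ := hns
  -- `Sel(E)` is the relaxed group
  have hcns : c ∉ (kummerStrict W p S).selmerGroup :=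
    not_mem_selmerGroup_kummerStrict_of_localization_ne_zero W p S hv₀S hc
  have hK : (W.kummerSelmerStructure (p : ℤ)).selmerGroup = (kummerRelaxed W p S).selmerGroup := by
    rcases eq_or_eq_of_le_of_le_of_relIndex_prime hp.out hKlo hKhi hidx with h | h
    · exact absurd (h ▸ hcK) hcns
    · exact h
  -- `H¹_𝓐` is the strict group (transversality)
  have hA : 𝓐.selmerGroup = (kummerStrict W p S).selmerGroup := by
    rcases eq_or_eq_of_le_of_le_of_relIndex_prime hp.out hAlo hAhi hidx with h | h
    · exact h
    · exfalso
      have hcA : c ∈ 𝓐.selmerGroup := by rw [h, ← hK]; exact hcK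
      have h𝓐v := (SelmerStructure.mem_selmerGroup_iff _ _).mp hcA (Sum.inr v₀)
      have hKv := (SelmerStructure.mem_selmerGroup_iff _ _).mp hcK (Sum.inr v₀)
      have hbot : galoisCohomology.localization (W.torsionGaloisModule (p : ℤ)) (Sum.inr v₀) 1 c ∈
          𝓐 (Sum.inr v₀) ⊓ W.kummerSelmerStructure (p : ℤ) (Sum.inr v₀) :=
        AddSubgroup.mem_inf.mpr ⟨h𝓐v, hKv⟩
      rw [htr, AddSubgroup.mem_bot] at hbot
      exact hc hbot
  -- counting
  have hcount := card_mul_relIndex_of_le (hAlo.trans hAhi)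
  rw [hidx, ← hA, ← hK] at hcount
  rw [← natCard_selmerGroup_transport_kummer W Y p φ ψ hψφ hφψ 𝓐 h𝓐,
    selmerGroup_eq_selmerGroup_kummerSelmerStructure]
  exact hcount

end Down

end Summit.BirchSwinnertonDyer.BirchSwinnertonDyer.Theorems.GenusKolyTwistLocal

end
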